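import Summits.BirchSwinnertonDyer.BirchSwinnertonDyer.Theorems.DefiniteThetaDerivedHeightCapTowerSqrtGenerators
import Summits.BirchSwinnertonDyer.BirchSwinnertonDyer.Theorems.DefiniteThetaDerivedHeightCapTowerSqrtCore
import HarnessLib

/-!
# The square root along the anticyclotomic tower: `θ_n^{ac} · ι(θ_n^{ac}) ∈ I_n^{2ρ}` for all `n` ⇒ `θ_n^{ac} ∈ I_n^ρ` for all `n`
# (`K` imaginary quadratic, `p` odd) — stub `stub_towerSqrt` of crux `DerivedHeightCap` in the generality the line uses

Route-independent `Theorems` file (cell `b2b-bsdres`, seat `b2b-bsdres-x10b`, gen 44), part 8 (assembly) of the series «tower square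
root» serving crux `DerivedHeightCap` (stmt-BirchSwinnertonDyer-18438, route DefiniteTheta, line «birth»).
HONEST FRAMING: no curve asserted, no class closed, BSD not proved by any of this.

**Theorem** (`towerSqrt_of_isImaginaryQuadratic`). Let `K` be an imaginary quadratic field, `p` an odd prime, `S` a Brandt setup, `T` a
tower of Gross points of conductor `p^n`, `φ` weights, `α ∈ ℤ_pˣ`, with `(θ_n)` norm-compatible (`T.IsNormCompatible p φ α`). If
`θ_n^{ac} · ι(θ_n^{ac}) ∈ I_n^{2ρ}` in `ℤ_p[Pic(𝒪_{p^{n+1}})/Δ]` for every `n`, then `T.VanishesToOrderAc p φ α ρ` (`θ_n^{ac} ∈ I_n^ρ`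
for every `n`). This is the registered stub `stub_towerSqrt` with the two hypotheses `IsImaginaryQuadratic K`, `p ≠ 2` ADDED — exactly
what the line's assembly `DerivedHeightCap_of_stubs` feeds it (`Module.finrank ℚ K = 2 ∧ NumberField.IsTotallyComplex K`, `7 ≤ p`);
the registered signature quantifies over every number field `K` and every prime `p` (see the reshaped skeleton attached to the item).

Proof = parts 1–7: the layer groups `Q_{n+1} = Pic(𝒪_{p^{n+1}})/Δ` are finite cyclic `p`-groups with coherent generators and
unbounded orders (parts 5–7, from the `torsionImage` structure theorems of gen 43), `θ^{ac}` is coherent along `Q_{n+2} → Q_{n+1}`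
(BD96 Prop. 2.7 = `IsNormCompatible`), and the abstract square root along a `ℤ_p`-tower (part 3, by `p`-adic jets) applies.

## References
* [BertoliniDarmon2005] §1.2 (18)–(21) and Cor. 3; [BertoliniDarmon1996] Prop. 2.7, §2.12; [Washington1997] §7.1, §13.2.
-/

noncomputable section

open scoped BigOperators

-- D-0017: single-problem summit, the namespace repeats the problem name by design.
set_option linter.dupNamespace false

namespace Summit.BirchSwinnertonDyer.BirchSwinnertonDyer.Theorems.TowerSqrt

open Literature.NumberTheory.EllipticCurves Literature.NumberTheory.EllipticCurves.QuadOrderTower NumberField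
  Literature.NumberTheory.Automorphic
open Summit.BirchSwinnertonDyer.BirchSwinnertonDyer.Theorems.DefmuSupersingularTheta (picRes_mem_torsionImage)

-- The statement below elaborates `ℤ_p[Pic(𝒪_{p^{n+1}})/Δ]`-arithmetic; in this import closure the typeclass search for the
-- quotient group (normality via `IsMulCommutative (ClassGroup _)`, where `IsCyclic.isMulCommutative` is tried first) needs slightly
-- more than the default 20000 heartbeats (measured: 30000 suffice). Inside the proof a local instance short-cuts it.
set_option synthInstance.maxHeartbeats 40000 in
/-- **The square root along the anticyclotomic tower** (stub `stub_towerSqrt` of crux `DerivedHeightCap`, line «birth», for `K` imaginary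
quadratic and `p` odd — the generality used by the line's assembly). For a norm-compatible tower of theta elements:
`θ_n^{ac} · ι(θ_n^{ac}) ∈ I_n^{2ρ}` for every `n` implies `θ_n^{ac} ∈ I_n^{ρ}` for every `n` (`T.VanishesToOrderAc p φ α ρ`), i.e.
Bertolini–Darmon's "`L_p(E,K) = L_f L_f^* ∈ J^{2ρ} ⇒ L_f ∈ J^ρ`" in `Λ = ℤ_p⟦G_∞⟧`, in finite-level form.
[cite: BertoliniDarmon2005, §1.2 (18)–(21) and Cor. 3] [cite: BertoliniDarmon1996, Prop. 2.7 and §2.12] -/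
theorem towerSqrt_of_isImaginaryQuadratic :
    ∀ (K : Type) [Field K] [NumberField K] (p : ℕ) [Fact p.Prime] (Nplus Nminus : ℕ)
      (S : Literature.NumberTheory.Automorphic.Brandt.XiSetup Nplus Nminus)
      (T : Literature.NumberTheory.EllipticCurves.GrossPointTower K S p)
      (φ : Literature.NumberTheory.Automorphic.Brandt.ClassSet S.O → ℤ) (α : ℤ_[p]ˣ),
      IsImaginaryQuadratic K → p ≠ 2 → T.IsNormCompatible p φ α → ∀ ρ : ℕ,
      (∀ n : ℕ, T.thetaAc p φ α n * MonoidAlgebra.mapDomain (fun σ => σ⁻¹) (T.thetaAc p φ α n) ∈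
        Literature.NumberTheory.EllipticCurves.augIdeal ℤ_[p] (Literature.NumberTheory.EllipticCurves.AcLayerGroup K p (n + 1)) ^
          (2 * ρ)) →
      T.VanishesToOrderAc p φ α ρ := by
  intro K _ _ p _ Nplus Nminus S T φ α hK hp2 hnc ρ hyp
  classical
  -- local instances: keep the typeclass search for the quotients away from `IsCyclic.isMulCommutative`
  haveI : ∀ m : ℕ, IsMulCommutative (ClassGroup (quadOrder K (p ^ m))) := fun m => CommMagma.to_isCommutative
  -- (1) the tower data: maps, coherent generators, orders
  have hle : ∀ n : ℕ, torsionImage K p (n + 1 + 1) ≤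
      (torsionImage K p (n + 1)).comap (picRes K (pow_dvd_pow p (n + 1).le_succ)) :=
    fun n t ht => Subgroup.mem_comap.mpr (picRes_mem_torsionImage p (n + 1).le_succ ht)
  let π : ∀ n : ℕ, AcLayerGroup K p (n + 1 + 1) →* AcLayerGroup K p (n + 1) := fun n =>
    QuotientGroup.map _ _ (picRes K (pow_dvd_pow p (n + 1).le_succ)) (hle n)
  obtain ⟨d, hdres, hdgen⟩ := exists_coherent_generators_mod_torsionImage p hK hp2
  let γ : ∀ n : ℕ, AcLayerGroup K p (n + 1) := fun n => QuotientGroup.mk' (torsionImage K p (n + 1)) (d n)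
  have hγ : ∀ n, π n (γ (n + 1)) = γ n := by
    intro n
    simp only [π, γ]
    rw [QuotientGroup.mk'_apply, QuotientGroup.map_mk, hdres]
    rfl
  have hgen : ∀ n (q : AcLayerGroup K p (n + 1)), ∃ k : ℕ, γ n ^ k = q := by
    intro n q
    obtain ⟨x, rfl⟩ := QuotientGroup.mk'_surjective (torsionImage K p (n + 1)) q
    obtain ⟨i, hi⟩ := hdgen n x
    refine ⟨i, ?_⟩
    simp only [γ]
    rw [← map_pow, QuotientGroup.mk'_apply, QuotientGroup.mk'_apply, QuotientGroup.eq]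
    have : (d n ^ i)⁻¹ * x = x * (d n ^ i)⁻¹ := mul_comm _ _
    rw [this]; exact hi
  have hfin : ∀ n, Finite (AcLayerGroup K p (n + 1)) := fun n => by
    haveI : Finite (ClassGroup (quadOrder K (p ^ (n + 1)))) := finite_classGroup (K := K) _
    exact Finite.of_surjective _ (QuotientGroup.mk'_surjective (torsionImage K p (n + 1)))
  choose e he hne using fun n => exists_natCard_acLayerGroup_eq p hK hp2 n
  have he_unb : ∀ N : ℕ, ∃ n, N ≤ e n := fun N => ⟨N, hne N⟩
  -- (2) θ^{ac} is coherent along π (from the norm-compatibility of θ)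
  have hθ : ∀ n, MonoidAlgebra.mapDomainRingHom ℤ_[p] (π n) (T.thetaAc p φ α (n + 1)) = T.thetaAc p φ α n := by
    intro n
    have hn := (mem_completedGroupRing_iff (K := K) (p := p)).mp hnc n
    show MonoidAlgebra.mapDomainRingHom ℤ_[p] (π n)
        (MonoidAlgebra.mapDomainRingHom ℤ_[p] (acProj K p (n + 1 + 1)) (T.theta p φ α (n + 1))) =
      MonoidAlgebra.mapDomainRingHom ℤ_[p] (acProj K p (n + 1)) (T.theta p φ α n)
    rw [← hn, groupRingProj, ← RingHom.comp_apply, ← RingHom.comp_apply, ← MonoidAlgebra.mapDomainRingHom_comp,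
      ← MonoidAlgebra.mapDomainRingHom_comp]
    congr 2
  -- (3) the abstract square root along the tower
  intro n
  exact mem_augIdeal_pow_of_mul_inv_mem p (G := fun n => AcLayerGroup K p (n + 1)) hfin π γ hγ hgen e he he_unb
    (fun n => T.thetaAc p φ α n) hθ ρ hyp n

end Summit.BirchSwinnertonDyer.BirchSwinnertonDyer.Theorems.TowerSqrt

end
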